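import Summits.ValiantsHypothesis.ValiantsHypothesis.Theses.FeketeSOS

/-! # Disproof of `CharPSparseSOS` (stmt-ValiantsHypothesis-14989) — standing disprover, cycle 1 — findings

Crux (★): `∃ δ>0 ∃ p₀ ∀ primes p ≥ p₀ ∀ K (char p) ∀ s ≤ p^δ, c, g (deg g_i < p):
X^p − 1 ∣ Σ c_i g_i² − F̄_p ⇒ p^{1/2+δ} ≤ Σ #supp g_i`.  Probe: rc 0, `Iff.rfl` readback; `1/2` is real; `s = 0` is
excluded (`F̄_p ≠ 0`, `deg < p`); the SAME `δ` couples the number of squares and the gain.  VERDICT OF THIS CYCLE: no kill.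
A refutation needs an INFINITE family (p₀ is free): for every δ, infinitely many p with `s ≤ p^δ` squares of total support
`< p^{1/2+δ}`; every structured ansatz tried returns support ≥ p − 1 or ≈ 0.6·p (list below).  What IS proved here
(all `lean check` rc 0, no sorry; filed under `Theorems/CharPSparseSOS/Negative/`: p99320 `LoadBearing.lean` (a), p99930
`ExponentBoundary.lean` (b), p100440 `DiagPoison.lean` (c) — verdicts pending at publication time):

(a) LOAD-BEARING HYPOTHESES
* `charPSparseSOS_false_without_prime` — primality of the modulus: with the Jacobi symbol at `N = q²`, characteristic `q`,
  `F̄_N = (X+⋯+X^{q−1})(1+X^q+⋯+X^{q(q−1)})` exactly; 4 squares, support-sum `≤ 4q − 2 < 4√N` (port of the parent's lemma to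
  `ZMod q`; the identity is characteristic-free, so the cyclic/char-p model gains nothing here).
* `charPSparseSOS_false_without_legendre` — the VALUES of χ_p: the all-ones pattern on `[1,p−1]` (in char p: `(X−1)^{p−1} − 1`,
  the socle line `z^{p−1} − 1` of `k[z]/(z^p)`) is 4 squares of support-sum `≤ 12√p` in `(ZMod p)[X]`, exactly, degree `< p`.
* degree bound `natDegree < p`: NOT load-bearing (fold exponents mod p: `X^n ≡ X^{n mod p}`, supports only shrink) — dropping it
  gives an equivalent statement (remark; no lemma filed).
* `CharP K p`: in characteristic 2 the statement is trivially TRUE (Frobenius: `supp Σ c_i g_i² ⊆ 2·∪ supp g_i`, so `S ≥ p−1`);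
  in characteristic 0 the cyclic relaxation is the route's open "cyclic relaxation over ℤ" — no cheap lemma either way.
* few squares `s ≤ p^δ`: with UNBOUNDEDLY many squares the only extra mechanism found is local: a window `g = Σ_{a<t} ρ^a X^{λ r^a}`
  (`ρ = ±1`, `χ(r) = 1`) reproduces χ_p on all `t(t−1)/2` off-diagonal sums iff `χ(1+r^k)ρ^k` is constant in `k < t`
  (`t − 3` binary coincidences; `#good r ≈ p·2^{2−t}`, confirmed numerically, exp/gp_sign_windows.py), its `t` diagonal
  positions are then ALL wrong (`diag_poison`) and must be patched by monomial squares; packing such windows gains at best a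
  `log p` factor over linear cost with `s = p^{1−o(1)}` squares at astronomically large p — it never threatens `p^{1/2+δ}` and is
  unavailable under `s ≤ p^δ`.  So `s ≤ p^δ` is plausibly NOT load-bearing for the exponent, only for constants.

(b) BOUNDARY
* `charPSparseSOS_exponent_boundary` — for every `δ > 1/2` the body of (★) is false (trivial representation
  `F̄ = (½(F̄+1))² − (½(F̄−1))²`, `S ≤ 2p`, `s = 2 ≤ p^δ`): admissible δ ⊂ (0, 1/2], as `ExponentHalf` for splittings.
* `s = 1` (one weighted square, p ≡ 1 mod 4): the LRS bound `#supp g ≥ (p+1)/2` quoted in the item is NOT tight — exact minima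
  (exhaustive, exp/s1_min_support.py; the problem is the covering radius of `z^{(p−1)/4}` w.r.t. the MDS code `(X−1)^{(3p+1)/4}·K[X]_{<(p−1)/4}`):
  p = 5: 4, p = 13: 8, p = 17: 11; sampled upper bounds p = 29: 18, 37: 23, 41: 25 (≈ 0.6 p).

(c) SMALL-MODEL STRUCTURE / STRENGTHENINGS
* `diag_poison` — in char `p > 5`, `2cxy = ±1 ∧ cx² = ±1 ∧ cy² = ±1` is inconsistent (`16 = 1`).  Hence: an off-diagonal sum
  `a+b` of one square that receives no other contribution forces one of the diagonals `2a, 2b` to be a collision or a mismatch;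
  "each position exactly once" sumset packings NEVER represent F̄_p; cheap representations carry ≳ `Σ #supp g_i` forced additive
  coincidences (midpoints `2a = b + c` or cross-square overlaps).  Quantitatively this only sharpens counting to `Σ t_i(t_i−1) ≳ 2p`.
* LINEAR FORM `(p+3)/4 ≤ S` for EVERY s (the item's conjectured truth): holds for all primes `p ≤ 43` by theory alone — `s = 1`: LRS;
  `s = 2` = one product `(αg₁+βg₂)(αg₁−βg₂)` over `K̄` ⇒ `(p+3)/2 ≤ 2(t₁+t₂)` by `stub_cyclicOrderDichotomy` + `cpf_main` +
  `stub_feketeModPOrder` (valid over every field of char p); patterns with ≥ 3 squares and `T ≤ (p−1)/4` fail the counting bound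
  `Σ t_i(t_i+1)/2 ≥ p − 1` below `p = 47`.  First computational cases, relaxed to "one t-sparse square agrees with F̄_p off ≤ k
  positions" (exp/linear/enum.c, exact: coverage + the diag_poison matching bound, then algebraic stage if anything survives):
  `E(43,9,2) = E(47,10,2) = E(47,9,4) = E(53,11,2) = E(53,10,4) = E(53,9,7) = ∅` (e.g. `E(53,11,2)`: 5.3·10⁹ supports visited,
  4724 pass coverage, 0 pass the diagonal filter; the best 9-set of ℤ/47 leaves 6 non-zero residues uncovered).  CONCLUSION: the
  linear form holds for EVERY s over every field of characteristic p at ALL primes `p ≤ 53` (evidence LinearFormP53.md on the item).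
  DIAGONAL COUNTING BOUND (general consequence of `diag_poison`, proof in the evidence file): fat squares `t_1..t_{s'}` (≥ 2) plus `k`
  one-term squares need `Σ t_i² + s' + 3k ≥ 2(p−1)` (plain counting has `Σ t_i² + Σ t_i + 2k`: the diagonal contributions do not
  help).  It kills e.g. (9,5,1), (9,4,2), (8,6,1) at p = 59; the 15 patterns left there need kit-sized runs `E(59,13,2)`, `E(59,12,4)`,
  `E(59,11,7)`, `E(59,10,11)` + the algebraic stage — running as ONE kit job j017487 (64 cores; results auto-attached to the item;
  survivors of the (10,·) shapes, if any, need a genuine two-square stage).  Beyond the threshold: `S_min(29) ≥ 11`, `S_min(31) ≥ 11`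
  for every s (E(29,8,3): 17393 filter-survivors, all infeasible in the algebraic stage; details in the evidence file).
* The prime-POWER analogue is false at the linear level (ideator-1 BarrierNotes: `k[𝔽_{p²}]`, `4(p+1)` squares, support `≈ 6 q^{3/4}`),
  untouched by (★) (`s ~ √q`).  Recorded, not re-derived.
* DEAD ANSÄTZE (why (★) resists): (i) digit/mixed-radix products: rank of `(χ(i+aj))` is full ⇒ cost ≥ `ab ≈ p` at every aspect
  ratio; (ii) coset / Gauss-period / dilation-orbit squares `g_i = g(X^{λ_i})`: by Mellin transform on `𝔽_p^×` (semisimple in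
  char p), `χ = (f⊛f) ∗ c` forces `#dilations · #supp g ≥ p − 1` — equivariance under `μ_m` costs `t ≥ m` and leaves `(p−1)/m`
  cosets to weight; (iii) full `μ_t`-orbit squares need `≈ t/2` sign coincidences `χ(1+ζ^k)θ^k = const` with only `φ(t)` candidates
  ζ — hopeless for `t ≫ log p`; (iv) many thin squares: (a) above; (v) near-Sidon few-fat-squares packings: each `S_i` must be a
  signed Paley SUM-clique (`χ(a+b) = C σ_a σ_b`), which Hanson–Petridis allows up to `√(p/2)`, BUT the `T` diagonals are all
  poisoned (`diag_poison`) and cannot be patched with `≤ p^δ` extra squares.  Net: no mechanism produces `S = p^{1/2+o(1)}` with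
  `s = p^{o(1)}`; the realistic negative statements are about CONSTANTS (linear form), not the exponent.

-- Line `Sketch` (lead prover-line-stmt-ValiantsHypothesis-14989-0; skeleton = two-cusp composition, stubs 1–7):
* `CharPSparseSOS_of` is kernel-checked from stubs 1, 2, 7 — no gap in joint sufficiency.
* Stubs 1–6 paper-audited SOUND including edge cases: stub 3 at `D = p` (both sides ⇔ `P = 0`, Vandermonde on `0..p−1` with
  `0^0 = 1`); stub 4 (`(U−n)^{p−1} = Σ_k n^{p−1−k}U^k` since `C(p−1,k) ≡ (−1)^k`; constant term `= P_0`); stub 5 for `D ≥ p`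
  (hypotheses force `g = 0`: vacuous; `D = p−1` tight at `g = Σ_{n≠0} X^n`); stub 6 at `D ≥ p` (the truncated exponent
  `p−1−d = 0` reproduces `Σ W_n = −P_0`, consistent) and at `p = 2`; stubs 1–2 are Euler + power sums (stub 1 landed as
  `Theorems/FeketeSOSCharPSparseSOSStubFeketeCuspInf.lean`).
* Stub 7 `stub_twoCuspInequality` (UFA² with power saving θ < 2) — NOT refuted; why it resists cheap refutation: two-sided depth
  `D` of `h` means `h ⊥ {n^a : |a| < D}` (a window of `2D−1` consecutive moments), so `#supp h ≥ 2D` (Laurent–Vandermonde) and the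
  extremal `h` on a support Σ (`#Σ = 2D`) is unique: `h_Σ(n) = n^{D−1}/w_Σ'(n)` (`Σ = 𝔽_p^×` gives `−χ_p`, `Σ = μ_{2D}` the quadratic
  character of `μ_{2D}`, `Σ = [1,2D]` gives `θ^{D−1}(X(1−X)^{2D−1})`).  Generic dimension count for `s` squares of total support `T`
  on sumsets of size σ: `T − (2D−1) ≥ 1`, i.e. `D ≲ T/2` — exactly the scan maxima 0.44–0.60 (card §4).  Refuting the θ<2 form needs
  `D ≥ T^{2−o(1)}` with `s = O(1)`: a near-Sidon sumset carrying (a multiple of) its extremal `h_Σ` — i.e. `χ`-free "rank-one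
  Cauchy–Vandermonde" coincidences `f(x)f(y) = F(x+y)`, `F = n^{D−1}/w'`; none known, and at bounded `T` the constant `C₀` absorbs
  every finite configuration, so NO bounded search can refute stub 7 as registered (only the card's sharp form `C₀ = 1, θ = 1` is
  falsifiable by search; its calibration world — coset-class functions + the free all-ones — provably satisfies `C₀ = 1` by the LRS
  gap principle on `μ_T`, as the card says).  Trivial but worth fixing in the stub's docstring: `θ ≥ 1` is FORCED — the target itself
  (`P = F̄_p`, both depths `M = (p−1)/2` by stubs 1–2, two squares `(½(F̄±1))²`, `T ≤ 2p`) violates `M ≤ C₀·3^{A₀}·(2p)^θ` for every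
  `θ < 1` and large p; so the admissible range is exactly `1 ≤ θ < 2`, with the card's `θ = 1` at its floor.  Recommendation to the lead: the first honest test of UFA² beyond half-linear scans is
  the fully bilinear two-product Gröbner search at p = 11, 13 named in the card (falsifier (b)); the disprover's filters above do not
  apply to it (no target χ).
-- Targets: none this cycle (payload.stuck_stubs = []).
-/

set_option linter.dupNamespace false

namespace Summit.ValiantsHypothesis.ValiantsHypothesis.Cruxes.CharPSparseSOS.Disproof

open Polynomial Finset

noncomputable section

variable {K : Type} [Field K]

/-- The four polynomials `P+Q, P-Q, M+T, M-T` of the two-products-are-four-squares identity. [folklore] -/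
def sqg (P Q M T : K[X]) : Fin 4 → K[X] := ![P + Q, P - Q, M + T, M - T]

/-- The weights `1/4, -1/4, 1/4, -1/4`. [folklore] -/
def sqc (K : Type) [Field K] : Fin 4 → K := ![1 / 4, -1 / 4, 1 / 4, -1 / 4]

/-- `PQ + MT = ¼(P+Q)² − ¼(P−Q)² + ¼(M+T)² − ¼(M−T)²` whenever `4 ≠ 0` in `K`. -/
theorem sqg_sum (h4 : (4 : K) ≠ 0) (P Q M T : K[X]) :
    (∑ i, C (sqc K i) * sqg P Q M T i ^ 2) = P * Q + M * T := by
  have h4' : C (1 / 4 : K) * 4 = 1 := by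
    rw [show (4 : K[X]) = C 4 from (map_ofNat C 4).symm, ← C_mul, ← C_1]
    congr 1; field_simp
  have hneg : C (-1 / 4 : K) = -C (1 / 4 : K) := by
    rw [← map_neg]; congr 1; ring
  simp only [Fin.sum_univ_four, sqg, sqc, Matrix.cons_val_zero, Matrix.cons_val_one, Matrix.cons_val_two,
    Matrix.cons_val_three, Matrix.head_cons, Matrix.tail_cons, hneg]
  linear_combination (P * Q + M * T) * h4'

/-- `|supp (P+Q)| ≤ |supp P| + |supp Q|`. -/
theorem card_support_add_le (P Q : K[X]) :
    (P + Q).support.card ≤ P.support.card + Q.support.card :=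
  (card_le_card support_add).trans (card_union_le _ _)

/-- `|supp (P−Q)| ≤ |supp P| + |supp Q|`. -/
theorem card_support_sub_le (P Q : K[X]) :
    (P - Q).support.card ≤ P.support.card + Q.support.card := by
  have := card_support_add_le P (-Q); rwa [support_neg, ← sub_eq_add_neg] at this

/-- Support-sum of the four squares is at most twice the supports of the four factors. -/
theorem sqg_support (P Q M T : K[X]) :
    (∑ i, ((sqg P Q M T i).support.card : ℝ)) ≤
      2 * (P.support.card + Q.support.card + M.support.card + T.support.card) := by
  simp only [Fin.sum_univ_four, sqg, Matrix.cons_val_zero, Matrix.cons_val_one, Matrix.cons_val_two,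
    Matrix.cons_val_three, Matrix.head_cons, Matrix.tail_cons]
  have e1 : ((P + Q).support.card : ℝ) ≤ P.support.card + Q.support.card := by
    exact_mod_cast card_support_add_le P Q
  have e2 : ((P - Q).support.card : ℝ) ≤ P.support.card + Q.support.card := by
    exact_mod_cast card_support_sub_le P Q
  have e3 : ((M + T).support.card : ℝ) ≤ M.support.card + T.support.card := by
    exact_mod_cast card_support_add_le M T
  have e4 : ((M - T).support.card : ℝ) ≤ M.support.card + T.support.card := by
    exact_mod_cast card_support_sub_le M T
  linarith

/-- The four squares have degree at most the maximum degree of the four factors. -/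
theorem sqg_natDegree (P Q M T : K[X]) (D : ℕ) (hP : P.natDegree ≤ D) (hQ : Q.natDegree ≤ D)
    (hM : M.natDegree ≤ D) (hT : T.natDegree ≤ D) : ∀ i, (sqg P Q M T i).natDegree ≤ D := by
  intro i
  fin_cases i
  · exact (natDegree_add_le _ _).trans (max_le hP hQ)
  · exact (natDegree_sub_le _ _).trans (max_le hP hQ)
  · exact (natDegree_add_le _ _).trans (max_le hM hT)
  · exact (natDegree_sub_le _ _).trans (max_le hM hT)

/-- Support of a finite sum of polynomials is at most the sum of the supports. -/
theorem card_support_sum_le {ι : Type*} (s : Finset ι) (f : ι → K[X]) :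
    (∑ i ∈ s, f i).support.card ≤ ∑ i ∈ s, (f i).support.card := by
  classical
  induction s using Finset.induction_on with
  | empty => simp
  | @insert a s ha ih =>
    rw [sum_insert ha, sum_insert ha]
    exact (card_support_add_le _ _).trans (by omega)

/-- A monomial `X^n` has at most one term. -/
theorem card_support_X_pow_le (n : ℕ) : ((X : K[X]) ^ n).support.card ≤ 1 := by
  rw [← one_mul (X ^ n), ← C_1]; exact card_support_C_mul_X_pow_le_one

/-- A sum of `|s|` monomials has at most `|s|` terms. -/
theorem card_support_sum_X_pow_le {ι : Type*} (s : Finset ι) (e : ι → ℕ) :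
    (∑ i ∈ s, (X : K[X]) ^ e i).support.card ≤ s.card := by
  refine (card_support_sum_le s _).trans ?_
  calc ∑ i ∈ s, ((X : K[X]) ^ e i).support.card ≤ ∑ _i ∈ s, 1 :=
        sum_le_sum fun i _ => card_support_X_pow_le (e i)
    _ = s.card := by simp

/-- Digit decomposition of `range (a*b)`: `m = k + a j`, `k < a`, `j < b`. -/
theorem sum_range_mul_eq {M : Type*} [AddCommMonoid M] (f : ℕ → M) (a b : ℕ) :
    ∑ m ∈ range (a * b), f m = ∑ j ∈ range b, ∑ k ∈ range a, f (k + a * j) := by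
  induction b with
  | zero => simp
  | succ b ih =>
    rw [Nat.mul_succ, sum_range_add, ih, sum_range_succ]
    congr 1
    exact sum_congr rfl fun k _ => by rw [add_comm]

variable (K)

/-- The cyclotomic-shadow "Fekete polynomial" of an arbitrary modulus `N` read in `K`, with the Jacobi symbol:
`∑_{m<N} J(m|N) X^m`; for prime `N` it is the crux's inlined `F̄_N`. [folklore] -/
def jacobiFekete (N : ℕ) : K[X] := ∑ m ∈ range N, C ((jacobiSym m N : ℤ) : K) * X ^ m

/-- low digits `x + x² + ⋯ + xⁿ`. [folklore] -/
def lowDigits (n : ℕ) : K[X] := ∑ k ∈ range n, X ^ (k + 1)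
/-- high digits `∑_{j<b} x^{a j}`. [folklore] -/
def highDigits (a b : ℕ) : K[X] := ∑ j ∈ range b, X ^ (a * j)

variable {K}

/-- `J(m | q²) = [q ∤ m]` for a prime `q`. -/
theorem jacobiSym_natCast_prime_sq (q : ℕ) [Fact q.Prime] (m : ℕ) :
    jacobiSym (m : ℤ) (q ^ 2) = if q ∣ m then 0 else 1 := by
  have : NeZero q := ⟨(Fact.out : q.Prime).ne_zero⟩
  rw [sq, jacobiSym.mul_right, ← jacobiSym.legendreSym.to_jacobiSym]
  by_cases h : q ∣ m
  · have h0 : ((m : ℤ) : ZMod q) = 0 := by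
      rw [Int.cast_natCast, ZMod.natCast_eq_zero_iff]; exact h
    rw [if_pos h, (legendreSym.eq_zero_iff q (m : ℤ)).mpr h0, zero_mul]
  · have h0 : ((m : ℤ) : ZMod q) ≠ 0 := by
      rw [Int.cast_natCast, Ne, ZMod.natCast_eq_zero_iff]; exact h
    rw [if_neg h, ← sq, legendreSym.sq_one q h0]

/-- `x + ⋯ + xⁿ` has at most `n` terms. -/
theorem card_support_lowDigits (n : ℕ) : (lowDigits K n).support.card ≤ n := by
  unfold lowDigits; simpa using card_support_sum_X_pow_le (K := K) (range n) (fun k => k + 1)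

/-- `∑_{j<b} x^{aj}` has at most `b` terms. -/
theorem card_support_highDigits (a b : ℕ) : (highDigits K a b).support.card ≤ b := by
  unfold highDigits; simpa using card_support_sum_X_pow_le (K := K) (range b) (fun j => a * j)

/-- `deg (x + ⋯ + xⁿ) ≤ n`. -/
theorem natDegree_lowDigits (n : ℕ) : (lowDigits K n).natDegree ≤ n :=
  natDegree_sum_le_of_forall_le _ _ fun k hk => (natDegree_X_pow_le _).trans (by
    have := mem_range.mp hk; omega)

/-- `deg ∑_{j<b} x^{aj} ≤ a (b - 1)`. -/
theorem natDegree_highDigits (a b : ℕ) : (highDigits K a b).natDegree ≤ a * (b - 1) :=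
  natDegree_sum_le_of_forall_le _ _ fun j hj => (natDegree_X_pow_le _).trans (by
    have := mem_range.mp hj; exact Nat.mul_le_mul_left a (by omega))

/-- The digit factorisation at a prime square, read in `K`:
`∑_{m<q²} J(m|q²) x^m = (x + ⋯ + x^{q-1}) · (1 + x^q + ⋯ + x^{q(q-1)})`. -/
theorem jacobiFekete_prime_sq (n : ℕ) [Fact (n + 1).Prime] :
    jacobiFekete K ((n + 1) ^ 2) = lowDigits K n * highDigits K (n + 1) (n + 1) := by
  unfold jacobiFekete lowDigits highDigits
  rw [sum_mul_sum, sq, sum_range_mul_eq, sum_comm, sum_range_succ']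
  have h0 : ∑ j ∈ range (n + 1), C ((jacobiSym ((0 + (n + 1) * j : ℕ) : ℤ) ((n + 1) * (n + 1)) : ℤ) : K) *
      X ^ (0 + (n + 1) * j) = 0 := by
    refine sum_eq_zero fun j _ => ?_
    rw [← sq, jacobiSym_natCast_prime_sq (n + 1), if_pos ⟨j, by ring⟩]; simp
  rw [h0, add_zero]
  refine sum_congr rfl fun k hk => sum_congr rfl fun j _ => ?_
  have hk' : k < n := mem_range.mp hk
  have hnd : ¬ (n + 1) ∣ (k + 1) + (n + 1) * j := by
    rw [Nat.dvd_add_left ⟨j, rfl⟩]; exact Nat.not_dvd_of_pos_of_lt (Nat.succ_pos k) (by omega)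
  rw [← sq, jacobiSym_natCast_prime_sq (n + 1) ((k + 1) + (n + 1) * j), if_neg hnd]
  simp [pow_add]

/-- Digit tiling of `x + ⋯ + x^{ab+r}`:
`= (x + ⋯ + x^a)(∑_{j<b} x^{aj}) + x^{ab+1}(1 + ⋯ + x^{r-1})`. -/
theorem ones_digit_identity (a b r : ℕ) :
    (∑ m ∈ range (a * b + r), (X : K[X]) ^ (m + 1)) =
      lowDigits K a * highDigits K a b + X ^ (a * b + 1) * ∑ k ∈ range r, X ^ k := by
  unfold lowDigits highDigits
  rw [sum_range_add, sum_mul_sum, sum_range_mul_eq, mul_sum]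
  refine congrArg₂ (· + ·) ?_ ?_
  · rw [sum_comm]
    refine sum_congr rfl fun k _ => sum_congr rfl fun j _ => ?_
    rw [← pow_add, show k + a * j + 1 = (k + 1) + a * j by ring]
  · refine sum_congr rfl fun k _ => ?_
    rw [← pow_add, show a * b + k + 1 = (a * b + 1) + k by ring]

/-- The all-ones pattern `ε m = [m ≠ 0]`. [folklore] -/
def onesPattern : ℕ → ℤ := fun m => if m = 0 then 0 else 1

/-- The all-ones pattern renders as `x + x² + ⋯ + x^N`. -/
theorem ones_poly_eq (N : ℕ) :
    (∑ m ∈ range (N + 1), C ((onesPattern m : ℤ) : K) * X ^ m) = ∑ m ∈ range N, (X : K[X]) ^ (m + 1) := by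
  rw [sum_range_succ']
  simp [onesPattern]


/-! ## (a) Load-bearing hypotheses -/

section LoadBearing

open Polynomial Finset

/-- `(4 : ZMod q) ≠ 0` for a prime `q ≥ 5`. -/
theorem four_ne_zero_zmod (q : ℕ) [Fact q.Prime] (hq : 5 ≤ q) : (4 : ZMod q) ≠ 0 := by
  intro h
  have h' : ((4 : ℕ) : ZMod q) = 0 := by exact_mod_cast h
  rw [ZMod.natCast_eq_zero_iff] at h'
  have := Nat.le_of_dvd (by norm_num) h'
  omega

/-- **Primality is load-bearing (cyclic, positive characteristic).**  The all-moduli variant of the crux —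
modulus `N`, Jacobi symbol, any prime characteristic `ℓ ∣ N`, cyclic mod `X^N − 1` — is false: at `N = q²`
(`q` prime), in characteristic `q`, `∑_{m<N} J(m|N) X^m = (X + ⋯ + X^{q-1})(1 + X^q + ⋯ + X^{q(q-1)})` EXACTLY
(degree `< N`, no folding needed), a 4-square representation of support-sum `≤ 4q − 2 < 4√N`.  So for every
`δ > 0` the bound `N^{1/2+δ}` fails as soon as `q^{2δ} ≥ 4`.  (Port of the parent's
`FeketeSOSHard.Negative.feketeSOSHard_false_without_prime` from `ℂ` to `ZMod q`; the identity is
characteristic-free.) [folklore; digit tiling] -/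
theorem charPSparseSOS_false_without_prime :
    ¬ (∃ δ : ℝ, 0 < δ ∧ ∃ N₀ : ℕ, ∀ N : ℕ, N₀ ≤ N → ∀ (ℓ : ℕ) [Fact ℓ.Prime], ℓ ∣ N →
        ∀ (K : Type) [Field K] [CharP K ℓ] (s : ℕ) (c : Fin s → K) (g : Fin s → K[X]),
          (s : ℝ) ≤ (N : ℝ) ^ δ → (∀ i, (g i).natDegree < N) →
          ((X : K[X]) ^ N - 1 ∣
              (∑ i, C (c i) * g i ^ 2) - ∑ m ∈ range N, C ((jacobiSym m N : ℤ) : K) * X ^ m) →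
          (N : ℝ) ^ (1 / 2 + δ) ≤ ∑ i, ((g i).support.card : ℝ)) := by
  rintro ⟨δ, hδ, N₀, h⟩
  obtain ⟨q, hq, hqprime⟩ := Nat.exists_infinite_primes (max (max N₀ (⌈(4 : ℝ) ^ (1 / δ)⌉₊ + 1)) 5)
  haveI : Fact q.Prime := ⟨hqprime⟩
  have hq5 : 5 ≤ q := le_of_max_le_right hq
  have h4 : (4 : ZMod q) ≠ 0 := four_ne_zero_zmod q hq5
  obtain ⟨n, rfl⟩ : ∃ n, q = n + 1 := ⟨q - 1, (Nat.succ_pred_eq_of_pos hqprime.pos).symm⟩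
  have hN₀ : N₀ ≤ (n + 1) ^ 2 :=
    le_trans (le_of_max_le_left (le_of_max_le_left hq)) (Nat.le_self_pow two_ne_zero _)
  have key := h ((n + 1) ^ 2) hN₀ (n + 1) (dvd_pow_self _ two_ne_zero) (ZMod (n + 1)) 4 (sqc (ZMod (n + 1)))
    (sqg (lowDigits (ZMod (n + 1)) n) (highDigits (ZMod (n + 1)) (n + 1) (n + 1)) 0 0)
  have hq1 : (1 : ℝ) ≤ ((n + 1 : ℕ) : ℝ) := by exact_mod_cast Nat.succ_le_succ (Nat.zero_le n)
  have hq0 : (0 : ℝ) ≤ ((n + 1 : ℕ) : ℝ) := le_trans zero_le_one hq1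
  have hceil : (4 : ℝ) ^ (1 / δ) ≤ ((n + 1 : ℕ) : ℝ) := by
    have h1 : (⌈(4 : ℝ) ^ (1 / δ)⌉₊ : ℝ) ≤ ((n + 1 : ℕ) : ℝ) := by
      exact_mod_cast le_trans (Nat.le_succ _) (le_of_max_le_right (le_of_max_le_left hq))
    exact le_trans (Nat.le_ceil _) h1
  have hcast : (((n + 1) ^ 2 : ℕ) : ℝ) = ((n + 1 : ℕ) : ℝ) ^ (2 : ℕ) := by push_cast; ring
  have hqδ : (4 : ℝ) ≤ ((n + 1 : ℕ) : ℝ) ^ δ := by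
    have : ((4 : ℝ) ^ (1 / δ)) ^ δ ≤ ((n + 1 : ℕ) : ℝ) ^ δ :=
      Real.rpow_le_rpow (by positivity) hceil hδ.le
    rwa [← Real.rpow_mul (by norm_num), one_div_mul_cancel hδ.ne', Real.rpow_one] at this
  have hNδ : (4 : ℝ) ≤ (((n + 1) ^ 2 : ℕ) : ℝ) ^ δ := by
    refine le_trans hqδ (Real.rpow_le_rpow hq0 ?_ hδ.le)
    rw [hcast]; exact le_self_pow₀ hq1 two_ne_zero
  have hsplit : (((n + 1) ^ 2 : ℕ) : ℝ) ^ (1 / 2 + δ) =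
      ((n + 1 : ℕ) : ℝ) * (((n + 1) ^ 2 : ℕ) : ℝ) ^ δ := by
    rw [Real.rpow_add (by positivity), hcast, ← Real.rpow_natCast_mul hq0]
    norm_num
  have hs : ((4 : ℕ) : ℝ) ≤ (((n + 1) ^ 2 : ℕ) : ℝ) ^ δ := by exact_mod_cast hNδ
  have hlt1 : n < (n + 1) ^ 2 := by nlinarith
  have hlt2 : (n + 1) * (n + 1 - 1) < (n + 1) ^ 2 := by
    rw [Nat.add_sub_cancel, sq]; exact Nat.mul_lt_mul_of_pos_left (Nat.lt_succ_self n) (Nat.succ_pos n)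
  have hdeg : ∀ i, (sqg (lowDigits (ZMod (n + 1)) n) (highDigits (ZMod (n + 1)) (n + 1) (n + 1)) 0 0 i).natDegree
      < (n + 1) ^ 2 := by
    have hle := sqg_natDegree (lowDigits (ZMod (n + 1)) n) (highDigits (ZMod (n + 1)) (n + 1) (n + 1)) 0 0
      ((n + 1) ^ 2 - 1) ((natDegree_lowDigits n).trans (by omega))
      ((natDegree_highDigits _ _).trans (by omega)) (by simp) (by simp)
    intro i; have := hle i; have h2 : 1 ≤ (n + 1) ^ 2 := Nat.one_le_pow _ _ (Nat.succ_pos n); omega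
  have hid : (∑ i, C (sqc (ZMod (n + 1)) i) *
      sqg (lowDigits (ZMod (n + 1)) n) (highDigits (ZMod (n + 1)) (n + 1) (n + 1)) 0 0 i ^ 2) =
      jacobiFekete (ZMod (n + 1)) ((n + 1) ^ 2) := by
    rw [sqg_sum h4, jacobiFekete_prime_sq, zero_mul, add_zero]
  have hdvd : ((X : (ZMod (n + 1))[X]) ^ ((n + 1) ^ 2) - 1 ∣
      (∑ i, C (sqc (ZMod (n + 1)) i) *
        sqg (lowDigits (ZMod (n + 1)) n) (highDigits (ZMod (n + 1)) (n + 1) (n + 1)) 0 0 i ^ 2) -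
      ∑ m ∈ range ((n + 1) ^ 2), C ((jacobiSym m ((n + 1) ^ 2) : ℤ) : ZMod (n + 1)) * X ^ m) := by
    rw [hid]; unfold jacobiFekete; rw [sub_self]; exact dvd_zero _
  have hbound := key hs hdeg hdvd
  have hsupp := sqg_support (lowDigits (ZMod (n + 1)) n) (highDigits (ZMod (n + 1)) (n + 1) (n + 1)) 0 0
  have hl : ((lowDigits (ZMod (n + 1)) n).support.card : ℝ) ≤ n := by
    exact_mod_cast card_support_lowDigits n
  have hh : ((highDigits (ZMod (n + 1)) (n + 1) (n + 1)).support.card : ℝ) ≤ (n + 1 : ℕ) := by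
    exact_mod_cast card_support_highDigits (n + 1) (n + 1)
  have hz : ((0 : (ZMod (n + 1))[X]).support.card : ℝ) = 0 := by simp
  rw [hz] at hsupp
  rw [hsplit] at hbound
  have hq' : ((n + 1 : ℕ) : ℝ) = n + 1 := by push_cast; ring
  rw [hq'] at hbound hqδ hh
  have h4q : 4 * ((n : ℝ) + 1) ≤ ((n : ℝ) + 1) * (((n + 1) ^ 2 : ℕ) : ℝ) ^ δ := by nlinarith
  linarith

/-- **The values of `χ_p` are load-bearing (cyclic, characteristic `p`).**  For EVERY prime `p ≥ 5` the all-ones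
pattern `X + X² + ⋯ + X^{p-1}` (a legal sign pattern: support `[1,p-1]`, coefficients `±1`) has, in `(ZMod p)[X]`,
the EXACT 4-square representation `sqg (lowDigits a) (highDigits a b) (X^{ab+1}) (1 + ⋯ + X^{r-1})` with
`a = ⌊√(p-1)⌋`, `p - 1 = ab + r`, `1 ≤ r ≤ a`, of degree `< p` and support-sum `≤ 2(a + b + 1 + r) ≤ 12√p
< p^{1/2+δ}` once `p^δ ≥ 13`.  So the all-sign-patterns variant of the crux is false in the cyclic characteristic-`p`
model too: the exponent must come from the values of `χ_p` (Euler's criterion), not from covering `[1,p-1]` by few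
sumsets.  In characteristic `p` the target is `(X−1)^{p−1} − 1`, i.e. `z^{p−1} − 1` in `k[z]/(z^p)`: the socle line
is cheap, the middle monomial `z^{(p−1)/2}` is the claim.  (Port of the parent's
`FeketeSOSHard.Negative.feketeSOSHard_false_without_legendre`.) [folklore] -/
theorem charPSparseSOS_false_without_legendre :
    ¬ (∃ δ : ℝ, 0 < δ ∧ ∃ p₀ : ℕ, ∀ (p : ℕ) [Fact p.Prime], p₀ ≤ p → ∀ ε : ℕ → ℤ, ε 0 = 0 →
        (∀ m, 0 < m → m < p → (ε m = 1 ∨ ε m = -1)) →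
        ∀ (K : Type) [Field K] [CharP K p] (s : ℕ) (c : Fin s → K) (g : Fin s → K[X]),
          (s : ℝ) ≤ (p : ℝ) ^ δ → (∀ i, (g i).natDegree < p) →
          ((X : K[X]) ^ p - 1 ∣ (∑ i, C (c i) * g i ^ 2) - ∑ m ∈ range p, C ((ε m : ℤ) : K) * X ^ m) →
          (p : ℝ) ^ (1 / 2 + δ) ≤ ∑ i, ((g i).support.card : ℝ)) := by
  rintro ⟨δ, hδ, p₀, h⟩
  obtain ⟨p, hp, hpprime⟩ := Nat.exists_infinite_primes (max (max p₀ (⌈(13 : ℝ) ^ (1 / δ)⌉₊ + 2)) 5)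
  haveI : Fact p.Prime := ⟨hpprime⟩
  have hp5 : 5 ≤ p := le_of_max_le_right hp
  have h4 : (4 : ZMod p) ≠ 0 := four_ne_zero_zmod p hp5
  obtain ⟨N, rfl⟩ : ∃ N, p = N + 1 := ⟨p - 1, (Nat.succ_pred_eq_of_pos hpprime.pos).symm⟩
  -- digits of N = p - 1 : N = a * b + r, a = ⌊√N⌋, 1 ≤ r ≤ a
  set a := Nat.sqrt N with ha
  set b := (N - 1) / a with hb
  set r := N - a * b with hr
  have hN4 : 4 ≤ N := by omega
  have ha1 : 1 ≤ a := by rw [ha]; exact Nat.le_sqrt.mpr (by nlinarith)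
  have hdm : N - 1 = a * b + (N - 1) % a := by rw [hb]; exact (Nat.div_add_mod (N - 1) a).symm
  have hmod : (N - 1) % a < a := Nat.mod_lt _ ha1
  have hNabr : N = a * b + r := by omega
  have hr1 : 1 ≤ r := by omega
  have hra : r ≤ a := by omega
  have haa : a * a ≤ N := by rw [ha]; exact Nat.sqrt_le N
  have hNlt : N < (a + 1) * (a + 1) := by rw [ha]; exact Nat.lt_succ_sqrt N
  have hb_le : b ≤ a + 2 := by
    rw [hb]
    have : N - 1 ≤ a * (a + 2) := by
      have : N ≤ a * (a + 2) := by nlinarith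
      omega
    calc (N - 1) / a ≤ (a * (a + 2)) / a := Nat.div_le_div_right this
      _ = a + 2 := Nat.mul_div_cancel_left _ ha1
  have hab : a * b ≤ N := by omega
  have haN : a ≤ N := (Nat.le_mul_self a).trans haa
  -- the witness
  set T : (ZMod (N + 1))[X] := ∑ k ∈ range r, X ^ k with hT
  set M : (ZMod (N + 1))[X] := X ^ (a * b + 1) with hM
  have key := h (N + 1) (le_trans (le_of_max_le_left (le_of_max_le_left hp)) le_rfl) onesPattern rfl
    (fun m hm _ => by simp [onesPattern, hm.ne']) (ZMod (N + 1)) 4 (sqc (ZMod (N + 1)))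
    (sqg (lowDigits (ZMod (N + 1)) a) (highDigits (ZMod (N + 1)) a b) M T)
  -- reals
  have hp1 : (1 : ℝ) ≤ ((N + 1 : ℕ) : ℝ) := by exact_mod_cast Nat.succ_le_succ (Nat.zero_le N)
  have hp0 : (0 : ℝ) < ((N + 1 : ℕ) : ℝ) := lt_of_lt_of_le zero_lt_one hp1
  have hceil : (13 : ℝ) ^ (1 / δ) ≤ ((N + 1 : ℕ) : ℝ) := by
    have h1 : (⌈(13 : ℝ) ^ (1 / δ)⌉₊ : ℝ) ≤ ((N + 1 : ℕ) : ℝ) := by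
      have : ⌈(13 : ℝ) ^ (1 / δ)⌉₊ ≤ N + 1 :=
        le_trans (by omega) (le_of_max_le_right (le_of_max_le_left hp))
      exact_mod_cast this
    exact le_trans (Nat.le_ceil _) h1
  have hpδ : (13 : ℝ) ≤ ((N + 1 : ℕ) : ℝ) ^ δ := by
    have : ((13 : ℝ) ^ (1 / δ)) ^ δ ≤ ((N + 1 : ℕ) : ℝ) ^ δ :=
      Real.rpow_le_rpow (by positivity) hceil hδ.le
    rwa [← Real.rpow_mul (by norm_num), one_div_mul_cancel hδ.ne', Real.rpow_one] at this
  have hs : ((4 : ℕ) : ℝ) ≤ ((N + 1 : ℕ) : ℝ) ^ δ := le_trans (by norm_num) hpδ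
  have hsplit : ((N + 1 : ℕ) : ℝ) ^ (1 / 2 + δ) = Real.sqrt ((N + 1 : ℕ) : ℝ) * ((N + 1 : ℕ) : ℝ) ^ δ := by
    rw [Real.rpow_add hp0, ← Real.sqrt_eq_rpow]
  -- degrees (< p = N + 1)
  have hdeg : ∀ i, (sqg (lowDigits (ZMod (N + 1)) a) (highDigits (ZMod (N + 1)) a b) M T i).natDegree < N + 1 := by
    have hle := sqg_natDegree (lowDigits (ZMod (N + 1)) a) (highDigits (ZMod (N + 1)) a b) M T N
      ((natDegree_lowDigits a).trans haN)
      ((natDegree_highDigits a b).trans (le_trans (Nat.mul_le_mul_left a (Nat.sub_le b 1)) hab))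
      (by rw [hM]; exact (natDegree_X_pow_le _).trans (by omega))
      (by
        rw [hT]
        exact natDegree_sum_le_of_forall_le _ _ fun k hk => (natDegree_X_pow_le _).trans (by
          have := mem_range.mp hk; omega))
    intro i; exact Nat.lt_succ_of_le (hle i)
  -- the identity (exact, hence cyclic)
  have hid : (∑ i, C (sqc (ZMod (N + 1)) i) * sqg (lowDigits (ZMod (N + 1)) a) (highDigits (ZMod (N + 1)) a b) M T i ^ 2) =
      ∑ m ∈ range (N + 1), C ((onesPattern m : ℤ) : ZMod (N + 1)) * X ^ m := by
    rw [sqg_sum h4, ones_poly_eq, hM, hT, ← ones_digit_identity a b r, ← hNabr]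
  have hdvd : ((X : (ZMod (N + 1))[X]) ^ (N + 1) - 1 ∣
      (∑ i, C (sqc (ZMod (N + 1)) i) *
          sqg (lowDigits (ZMod (N + 1)) a) (highDigits (ZMod (N + 1)) a b) M T i ^ 2) -
        ∑ m ∈ range (N + 1), C ((onesPattern m : ℤ) : ZMod (N + 1)) * X ^ m) := by
    rw [hid, sub_self]; exact dvd_zero _
  have hbound := key hs hdeg hdvd
  -- support-sum bookkeeping
  have hsupp := sqg_support (lowDigits (ZMod (N + 1)) a) (highDigits (ZMod (N + 1)) a b) M T
  have hl : ((lowDigits (ZMod (N + 1)) a).support.card : ℝ) ≤ a := by exact_mod_cast card_support_lowDigits a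
  have hh : ((highDigits (ZMod (N + 1)) a b).support.card : ℝ) ≤ b := by
    exact_mod_cast card_support_highDigits a b
  have hMc : (M.support.card : ℝ) ≤ 1 := by rw [hM]; exact_mod_cast card_support_X_pow_le _
  have hTc : (T.support.card : ℝ) ≤ r := by
    have : T.support.card ≤ r := by
      rw [hT]; exact (card_support_sum_X_pow_le (range r) id).trans (by simp)
    exact_mod_cast this
  have hb' : (b : ℝ) ≤ a + 2 := by exact_mod_cast hb_le
  have hr' : (r : ℝ) ≤ a := by exact_mod_cast hra
  have ha1' : (1 : ℝ) ≤ a := by exact_mod_cast ha1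
  have hsqrt : (a : ℝ) ≤ Real.sqrt ((N + 1 : ℕ) : ℝ) := by
    rw [← Real.sqrt_sq (Nat.cast_nonneg a)]
    apply Real.sqrt_le_sqrt
    have : ((a * a : ℕ) : ℝ) ≤ ((N + 1 : ℕ) : ℝ) := by exact_mod_cast haa.trans (Nat.le_succ N)
    push_cast at this ⊢; nlinarith
  have hsqrt1 : (1 : ℝ) ≤ Real.sqrt ((N + 1 : ℕ) : ℝ) := by
    rw [← Real.sqrt_one]; exact Real.sqrt_le_sqrt hp1
  rw [hsplit] at hbound
  set S := ∑ i, ((sqg (lowDigits (ZMod (N + 1)) a) (highDigits (ZMod (N + 1)) a b) M T i).support.card : ℝ) with hS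
  set sq := Real.sqrt ((N + 1 : ℕ) : ℝ) with hsqdef
  set pδ := ((N + 1 : ℕ) : ℝ) ^ δ with hpδdef
  have h1 : S ≤ 12 * sq := by nlinarith
  have h2 : 13 * sq ≤ sq * pδ := by nlinarith
  have h3 : 0 < sq := lt_of_lt_of_le zero_lt_one hsqrt1
  linarith

end LoadBearing

/-! ## (b) Boundary / tightness -/

section Boundary

open Polynomial Finset

/-- `#supp (C a * (F + C b)) ≤ p` for `deg F < p`. -/
theorem card_support_affine_le {K : Type} [Field K] (p : ℕ) (F : K[X]) (hF : F.natDegree < p) (a b : K) :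
    (C a * (F + C b)).support.card ≤ p := by
  refine (card_supp_le_succ_natDegree _).trans ?_
  have h1 : (C a * (F + C b)).natDegree ≤ F.natDegree := by
    refine (natDegree_C_mul_le _ _).trans ((natDegree_add_le _ _).trans ?_)
    rw [natDegree_C]; exact max_le le_rfl (Nat.zero_le _)
  omega

/-- **The exponent coupling caps `δ` at `1/2`.**  In `CharPSparseSOS` the SAME `δ` bounds the number of squares
(`s ≤ p^δ`) and the gain (`Σ #supp ≥ p^{1/2+δ}`); the body is false for every `δ > 1/2`, by the trivial two-square
representation `F̄_p = (½(F̄_p+1))² − (½(F̄_p−1))²` of support-sum `≤ 2p < p^{1/2+δ}` (`s = 2 ≤ p^δ`).  So an admissible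
`δ` lies in `(0, 1/2]`; together with the landed one-product bound `(p+3)/2` (any `δ < 1/2` works at `s ≤ 2`) this pins
the true range of the crux's exponent to `(0, 1/2)` ∪ possibly `{1/2}`, exactly as `FeketeNoSparseSplit.Negative.ExponentHalf`
does for splittings. [folklore] -/
theorem charPSparseSOS_exponent_boundary (δ : ℝ) (hδ : 1 / 2 < δ) :
    ¬ (∃ p₀ : ℕ, ∀ (p : ℕ) [Fact p.Prime], p₀ ≤ p → ∀ (K : Type) [Field K] [CharP K p] (s : ℕ) (c : Fin s → K)
        (g : Fin s → K[X]), (s : ℝ) ≤ (p : ℝ) ^ δ → (∀ i, (g i).natDegree < p) →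
        ((X : K[X]) ^ p - 1 ∣ (∑ i, C (c i) * g i ^ 2) - ∑ m ∈ range p, C ((legendreSym p m : ℤ) : K) * X ^ m) →
        (p : ℝ) ^ (1 / 2 + δ) ≤ ∑ i, ((g i).support.card : ℝ)) := by
  rintro ⟨p₀, h⟩
  have hη : 0 < δ - 1 / 2 := by linarith
  obtain ⟨p, hp, hpprime⟩ := Nat.exists_infinite_primes (max (max p₀ (⌈(2 : ℝ) ^ (1 / (δ - 1 / 2))⌉₊ + 1)) 5)
  haveI : Fact p.Prime := ⟨hpprime⟩
  have hp5 : 5 ≤ p := le_of_max_le_right hp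
  have h2 : (2 : ZMod p) ≠ 0 := by
    intro h0
    have h' : ((2 : ℕ) : ZMod p) = 0 := by exact_mod_cast h0
    rw [ZMod.natCast_eq_zero_iff] at h'
    have := Nat.le_of_dvd (by norm_num) h'
    omega
  set F : (ZMod p)[X] := ∑ m ∈ range p, C ((legendreSym p m : ℤ) : ZMod p) * X ^ m with hF
  have hFdeg : F.natDegree < p := by
    have hle : F.natDegree ≤ p - 1 := by
      rw [hF]
      refine natDegree_sum_le_of_forall_le _ _ fun m hm => (natDegree_C_mul_X_pow_le _ _).trans ?_
      have := mem_range.mp hm; omega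
    omega
  -- the witness: s = 2, c = (1, -1), g = (½(F+1), ½(F-1))
  have key := h p (le_of_max_le_left (le_of_max_le_left hp)) (ZMod p) 2 ![1, -1]
    ![C (1 / 2 : ZMod p) * (F + C 1), C (1 / 2 : ZMod p) * (F + C (-1))]
  have hid : (∑ i, C ((![1, -1] : Fin 2 → ZMod p) i) *
      (![C (1 / 2 : ZMod p) * (F + C 1), C (1 / 2 : ZMod p) * (F + C (-1))] i) ^ 2) = F := by
    simp only [Fin.sum_univ_two, Matrix.cons_val_zero, Matrix.cons_val_one]
    have hh : C (1 / 2 : ZMod p) * C (1 / 2 : ZMod p) * 4 = 1 := by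
      rw [show (4 : (ZMod p)[X]) = C 4 from (map_ofNat C 4).symm, ← C_mul, ← C_mul, ← C_1]
      congr 1
      rw [show (4 : ZMod p) = 2 * 2 by norm_num]
      field_simp
    simp only [map_one, map_neg]
    linear_combination F * hh
  have hdeg : ∀ i, ((![C (1 / 2 : ZMod p) * (F + C 1), C (1 / 2 : ZMod p) * (F + C (-1))] :
      Fin 2 → (ZMod p)[X]) i).natDegree < p := by
    intro i
    fin_cases i
    · show (C (1 / 2 : ZMod p) * (F + C 1)).natDegree < p
      refine lt_of_le_of_lt ((natDegree_C_mul_le _ _).trans ((natDegree_add_le _ _).trans ?_)) hFdeg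
      rw [natDegree_C]; exact max_le le_rfl (Nat.zero_le _)
    · show (C (1 / 2 : ZMod p) * (F + C (-1))).natDegree < p
      refine lt_of_le_of_lt ((natDegree_C_mul_le _ _).trans ((natDegree_add_le _ _).trans ?_)) hFdeg
      rw [natDegree_C]; exact max_le le_rfl (Nat.zero_le _)
  have hdvd : ((X : (ZMod p)[X]) ^ p - 1 ∣ (∑ i, C ((![1, -1] : Fin 2 → ZMod p) i) *
      (![C (1 / 2 : ZMod p) * (F + C 1), C (1 / 2 : ZMod p) * (F + C (-1))] i) ^ 2) - F) := by
    rw [hid, sub_self]; exact dvd_zero _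
  -- reals
  have hp1 : (1 : ℝ) < (p : ℝ) := by exact_mod_cast (show 1 < p by omega)
  have hp0 : (0 : ℝ) < (p : ℝ) := by linarith
  have hceil : (2 : ℝ) ^ (1 / (δ - 1 / 2)) < (p : ℝ) := by
    have h1 : ((⌈(2 : ℝ) ^ (1 / (δ - 1 / 2))⌉₊ + 1 : ℕ) : ℝ) ≤ (p : ℝ) := by
      exact_mod_cast le_of_max_le_right (le_of_max_le_left hp)
    push_cast at h1
    linarith [Nat.le_ceil ((2 : ℝ) ^ (1 / (δ - 1 / 2)))]
  have hpη : (2 : ℝ) < (p : ℝ) ^ (δ - 1 / 2) := by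
    have : ((2 : ℝ) ^ (1 / (δ - 1 / 2))) ^ (δ - 1 / 2) < (p : ℝ) ^ (δ - 1 / 2) :=
      Real.rpow_lt_rpow (by positivity) hceil hη
    rwa [← Real.rpow_mul (by norm_num), one_div_mul_cancel hη.ne', Real.rpow_one] at this
  have hs : ((2 : ℕ) : ℝ) ≤ (p : ℝ) ^ δ := by
    have h1 : (p : ℝ) ^ (δ - 1 / 2) ≤ (p : ℝ) ^ δ := Real.rpow_le_rpow_of_exponent_le hp1.le (by linarith)
    push_cast; linarith
  have hbound := key hs hdeg hdvd
  have hS : (∑ i, (((![C (1 / 2 : ZMod p) * (F + C 1), C (1 / 2 : ZMod p) * (F + C (-1))] :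
      Fin 2 → (ZMod p)[X]) i).support.card : ℝ)) ≤ 2 * (p : ℝ) := by
    simp only [Fin.sum_univ_two, Matrix.cons_val_zero, Matrix.cons_val_one]
    have e1 : ((C (1 / 2 : ZMod p) * (F + C 1)).support.card : ℝ) ≤ p := by
      exact_mod_cast card_support_affine_le p F hFdeg _ _
    have e2 : ((C (1 / 2 : ZMod p) * (F + C (-1))).support.card : ℝ) ≤ p := by
      exact_mod_cast card_support_affine_le p F hFdeg _ _
    linarith
  have hsplit : (p : ℝ) ^ (1 / 2 + δ) = (p : ℝ) * (p : ℝ) ^ (δ - 1 / 2) := by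
    rw [show (1 / 2 + δ : ℝ) = 1 + (δ - 1 / 2) by ring, Real.rpow_add hp0, Real.rpow_one]
  rw [hsplit] at hbound
  have : 2 * (p : ℝ) < (p : ℝ) * (p : ℝ) ^ (δ - 1 / 2) := by nlinarith
  linarith

end Boundary

/-! ## (c) Small-model structure: the diagonal obstruction -/

section Diagonal

/-- **Diagonal poisoning.**  In characteristic `p > 5` the three equations `2cxy = ε₁`, `cx² = ε₂`, `cy² = ε₃` with
`ε_i = ±1` are inconsistent (`ε₁² = 4ε₂ε₃` forces `16 = 1`).  Reading: in a cyclic representation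
`Σ c_i g_i² ≡ F̄_p`, if an off-diagonal sum `n = a + b` (`a ≠ b ∈ supp g_i`) receives no other contribution
(so its coefficient is `2c_i g_i(a) g_i(b) = χ_p(n) = ±1`), then the two diagonal positions `2a`, `2b` cannot BOTH
be clean (coefficient `c_i g_i(a)² = χ_p(2a)`): at least one of them is a collision (another pair of the same or
another square lands there) or a mismatch.  Consequences recorded in the module docstring: exact ("each position
once") sumset packings never represent `F̄_p` for `p > 5`; every cheap representation carries `≳ Σ_i #supp g_i`
forced additive coincidences; the single-fat-square patterns of the linear form die at `p = 47, 53` by this count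
alone (exp/linear). [folklore] -/
theorem diag_poison {K : Type} [Field K] (p : ℕ) [Fact p.Prime] [CharP K p] (hp : 5 < p)
    (c x y ε₁ ε₂ ε₃ : K) (h₁ : ε₁ ^ 2 = 1) (h₂ : ε₂ ^ 2 = 1) (h₃ : ε₃ ^ 2 = 1)
    (e₁ : 2 * c * x * y = ε₁) (e₂ : c * x ^ 2 = ε₂) (e₃ : c * y ^ 2 = ε₃) : False := by
  have h4 : (4 : K) * (ε₂ * ε₃) = 1 := by
    rw [← h₁, ← e₁, ← e₂, ← e₃]; ring
  have h16 : (16 : K) = 1 := by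
    linear_combination (4 * (ε₂ * ε₃) + 1) * h4 - 16 * ε₃ ^ 2 * h₂ - 16 * h₃
  have h15 : ((15 : ℕ) : K) = 0 := by
    have : (16 : K) - 1 = 0 := by rw [h16, sub_self]
    have e : ((15 : ℕ) : K) = (16 : K) - 1 := by push_cast; ring
    rw [e, this]
  rw [CharP.cast_eq_zero_iff K p] at h15
  have hle : p ≤ 15 := Nat.le_of_dvd (by norm_num) h15
  have hprime : p.Prime := Fact.out
  interval_cases p <;> first | exact absurd h15 (by decide) | exact absurd hprime (by decide)

end Diagonal

end

end Summit.ValiantsHypothesis.ValiantsHypothesis.Cruxes.CharPSparseSOS.Disproof
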